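import Summits.BirchSwinnertonDyer.BirchSwinnertonDyer.Theorems.SemiOrdinaryEisensteinDescentShaTwoCochainLayerNaturality
import Literature.NumberTheory.GaloisRepresentations.IdeleClassBarInvariant
import HarnessLib

/-!
# The Ш²-cochain bridge, step S3b (class side), second lemma: door-c6's transport `toAbsLayer` is BIJECTIVE on `Hⁿ`, and
# (T-Cα) two layer classes with the same continuous inflation in `H²_cont(Γ_K, lim)` have the same door-c4 inflation `Inf_E` —
# hence, for `C̄`, the same invariant `inv_{E/K}(iso_E ·)` (Serre CG I §2.2 Prop. 8; Tate, C–F VII §11.2 (bis))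

Route `SemiOrdinaryEisensteinDescent` (BSD, rung W-ALL row 2·3@3), Kolyvagin column, Cassels–Tate lane (print item
`CasselsTateLevelInputsFact`, stmt-BirchSwinnertonDyer-20191; crux `WildKolyvaginUpperAtThree`, stmt-BirchSwinnertonDyer-20480).
Sequel of `…ShaTwoCochainLayerNaturality` (p642812, w2 g11: `layerInf_toAbsLayer`), closing items (iii) and (T-Cα) of the memo
`Cruxes/WildKolyvaginUpperAtThree/S3-IDELE-DESCENT-w2g11.md` §3/§5:

* **`toAbsLayer_bijective`** / `toAbsLayer_injective` — for every layer `E`, every `X : C_Γ` and every degree `n`, door-c6's transport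
  `toAbsLayer E X n : Hⁿ(Γ_K ⧸ U_E, X^{U_E}) → Hⁿ(Γ_K ⧸ Γ_E, (toDGM X)^{Γ_E})` is a bijection: it IS the `hom` of Mathlib's
  `groupCohomology.mapIso` along `(quotEquivAbs E)⁻¹` and the identity-of-vectors linear equivalence `X^{U_E} ≃ (toDGM X)^{Γ_E}`
  (so no inverse morphism needs to be named; the memo's instance obstruction does not arise).
* **`inflG_eq_inflG_of_infTwo_toAbsLayer_eq`** (T-α, generic `X`) — if `w₁ ∈ H²(Γ_K ⧸ U_{E₁}, X^{U_{E₁}})` and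
  `w₂ ∈ H²(Γ_K ⧸ U_{E₂}, X^{U_{E₂}})` have the same continuous inflation `infTwo (toAbsLayer wᵢ) ∈ H²_cont(Γ_K, toDGM X)`, then
  `Inf_{E₁} w₁ = Inf_{E₂} w₂` in door-c4's `Ext²_{C_Γ}(ℤ, X)` (`LayerColimit.inflG`): by `infTwo_eq_infTwo_iff_exists_layerInf_eq` they agree
  after `layerInf` to a common finite Galois `E'`; by `layerInf_toAbsLayer` both sides are `toAbsLayer E'` of door-c4's transitions
  `stepG wᵢ`; by injectivity `stepG w₁ = stepG w₂`; and `Inf_{E'} ∘ stepG = Inf_{Eᵢ}` (`LayerColimit.inflG_stepG`).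
* **`layerInv_eq_layerInv_of_infTwo_toAbsLayer_eq`**, **`classInvAll_eq_classInvAll_of_infTwo_toAbsLayer_eq`** (T-Cα, `X = C̄`) —
  hence `layerInv E₁ w₁ = layerInv E₂ w₂`, i.e. `inv_{E₁/K}(iso_{E₁} w₁) = inv_{E₂/K}(iso_{E₂} w₂)` (door-c4 `classBarInv_inflG`:
  `inv_K (Inf_E w) = layerInv E w`): the number `classInvAll K E (iso_E w)` depends only on the class `infTwo (toAbsLayer w)` of
  `H²_cont(Γ_K, C̄)`.  This is the comparison through which the `J̄`-side sum `Σ_v inv_{K_v}[π_v Z|_v] = inv E₂ [b]` of an idèle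
  `2`-cocycle `Z` (w2 g11, `…ShaTwoCochainIdeleInvariantSum`) meets road B's readout `classBarInv K (Φ⁻¹[γ] ∘ ∂h) = layerInv E₁ w₁`
  (door-c4 `classBarInv_inflG_comp_boundary`) once both are written as continuous inflations of layer classes of `C̄` (sequel file).

THEOREMS ONLY (no definition, no instance, no instance attribute, no named fact, no `sorry`).  Bookkeeping over Serre's
`H^q(Γ, A) = lim→ H^q(Γ/U, A^U)`; no case of BSD, of Poitou–Tate or of Cassels–Tate is proved; BSD is not proved by any of this.
Width seat `bsd-wall-soed-p2-w3` g8; `--supports stmt-BirchSwinnertonDyer-20480`, helper.  Route-free (no `Theses` import).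

## References
* [SerreGaloisCohomology1997] J.-P. Serre, *Galois Cohomology* (1997), I §2.2 Proposition 8 and Corollary 1.
* [NeukirchSchmidtWingberg2008] J. Neukirch, A. Schmidt, K. Wingberg, *Cohomology of Number Fields* (2008), (1.5.1).
* [CasselsFrohlichANT1967] J. W. S. Cassels, A. Fröhlich (eds.), *Algebraic Number Theory* (1967), Ch. VII (J. Tate) §11.2 (bis).
-/

noncomputable section

set_option linter.dupNamespace false
set_option autoImplicit false

namespace Summit.BirchSwinnertonDyer.BirchSwinnertonDyer.Theorems.ShaTwoCochain

open CategoryTheory groupCohomology Field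
open Literature.NumberTheory.GaloisRepresentations Literature.NumberTheory.GaloisRepresentations.IdeleClassBar
open Literature.NumberTheory.GaloisRepresentations.DGMBridge Literature.NumberTheory.GaloisRepresentations.LayerDelta
open Literature.Algebra.Homology Literature.Algebra.Homology.DiscreteRep
open scoped ContRepresentation

variable {K : Type} [Field K]

/-! ## §1 `toAbsLayer` is a bijection in every degree -/

/-- **Door-c6's transport `toAbsLayer E X n : Hⁿ(Γ_K ⧸ U_E, X^{U_E}) → Hⁿ(Γ_K ⧸ Γ_E, (toDGM X)^{Γ_E})` is bijective** for every
layer `E`, every `X : C_Γ` and every `n`: it is the `hom` of Mathlib's `groupCohomology.mapIso` along the group isomorphism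
`(quotEquivAbs E)⁻¹ : Γ_K ⧸ U_E ≃* Γ_K ⧸ Γ_E` and the identity-of-vectors linear equivalence `X^{U_E} ≃ₗ[ℤ] (toDGM X)^{Γ_E}`
(`Γ_E = U_E` as subgroups, `absGaloisFixingSubgroup_eq_coe_openNormalSubgroup`).
[cite: SerreGaloisCohomology1997, I §2.2 Proposition 8] -/
theorem toAbsLayer_bijective (E : GalLayer K) [Normal K E.1] (X : DiscreteRepCat ℤ (absoluteGaloisGroup K)) (n : ℕ) :
    Function.Bijective (toAbsLayer E X n) := by
  letI i1 := ((invariantsQuotFunctor ℤ (E.openNormalSubgroup : Subgroup (absoluteGaloisGroup K))).obj X).hV2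
  letI i2 := (absGaloisLayerRep K E.1 (toDGM X)).hV2
  -- the identity of vectors `X^{U_E} ≃ (toDGM X)^{Γ_E}` as a linear equivalence
  let e' : ((invariantsQuotFunctor ℤ (E.openNormalSubgroup : Subgroup (absoluteGaloisGroup K))).obj X).V ≃ₗ[ℤ]
      (absGaloisLayerRep K E.1 (toDGM X)).V :=
    { toFun := toAbsLayerAddHom E X
      map_add' := fun w w' => map_add (toAbsLayerAddHom E X) w w'
      map_smul' := fun c w => by
        simpa only [Int.cast_id, RingHom.id_apply] using map_intCast_smul (toAbsLayerAddHom E X) ℤ ℤ c w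
      invFun := fun w => ⟨LCarrier.val X w.1, fun u =>
        congrArg (LCarrier.val X) (w.2 ⟨u.1, mem_absGaloisFixingSubgroup_of_mem E u.2⟩)⟩
      left_inv := fun _ => rfl
      right_inv := fun _ => rfl }
  have he : ∀ g, (e' : _ →ₗ[ℤ] _) ∘ₗ
      ((invariantsQuotFunctor ℤ (E.openNormalSubgroup : Subgroup (absoluteGaloisGroup K))).obj X).ρ g =
      (absGaloisLayerRep K E.1 (toDGM X)).ρ ((quotEquivAbs E).symm g) ∘ₗ (e' : _ →ₗ[ℤ] _) := fun g => by
    induction g using QuotientGroup.induction_on with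
    | H σ => exact LinearMap.ext fun w => Subtype.ext rfl
  have key : toAbsLayer E X n = (groupCohomology.mapIso (quotEquivAbs E).symm e' he n).hom := by
    rw [groupCohomology.mapIso_hom]
    exact map_congr (MonoidHom.ext fun _ => rfl) (LinearMap.ext fun _ => rfl) n
  rw [key]
  exact (groupCohomology.mapIso (quotEquivAbs E).symm e' he n).toLinearEquiv.bijective

/-- **`toAbsLayer E X n` is injective** (memo S3-IDELE-DESCENT-w2g11 §5 (iii)). [cite: SerreGaloisCohomology1997, I §2.2 Proposition 8] -/
theorem toAbsLayer_injective (E : GalLayer K) [Normal K E.1] (X : DiscreteRepCat ℤ (absoluteGaloisGroup K)) (n : ℕ) :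
    Function.Injective (toAbsLayer E X n) :=
  (toAbsLayer_bijective E X n).1

/-- **`toAbsLayer E X n` is surjective.** [cite: SerreGaloisCohomology1997, I §2.2 Proposition 8] -/
theorem toAbsLayer_surjective (E : GalLayer K) [Normal K E.1] (X : DiscreteRepCat ℤ (absoluteGaloisGroup K)) (n : ℕ) :
    Function.Surjective (toAbsLayer E X n) :=
  (toAbsLayer_bijective E X n).2

/-! ## §2 (T-α): equal continuous inflations ⟹ equal door-c4 inflations -/

/-- **(T-α).**  For `X : C_Γ` over a field of characteristic `0`, layers `E₁`, `E₂` and classes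
`wᵢ ∈ H²(Γ_K ⧸ U_{Eᵢ}, X^{U_{Eᵢ}})`: if the continuous inflations `infTwo (toAbsLayer Eᵢ X 2 wᵢ) ∈ H²_cont(Γ_K, toDGM X)` coincide,
then so do door-c4's inflations `Inf_{Eᵢ} wᵢ ∈ Ext²_{C_Γ}(ℤ, X)` (`LayerColimit.inflG`).  Proof: the two layer classes agree after
`layerInf` to a common finite Galois `E'` (`infTwo_eq_infTwo_iff_exists_layerInf_eq`, Serre I §2.2 Prop. 8 in degree `2`), i.e.
(`layerInf_toAbsLayer`) `toAbsLayer E' (stepG w₁) = toAbsLayer E' (stepG w₂)`; `toAbsLayer E'` is injective; and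
`Inf_{E'} (stepG wᵢ) = Inf_{Eᵢ} wᵢ` (`LayerColimit.inflG_stepG`).
[cite: SerreGaloisCohomology1997, I §2.2 Proposition 8][cite: NeukirchSchmidtWingberg2008, (1.5.1)] -/
theorem inflG_eq_inflG_of_infTwo_toAbsLayer_eq [CharZero K] (X : DiscreteRepCat ℤ (absoluteGaloisGroup K))
    (E₁ E₂ : GalLayer K) [Normal K E₁.1] [Normal K E₂.1] [FiniteDimensional K E₁.1] [FiniteDimensional K E₂.1]
    (w₁ : groupCohomology ((invariantsQuotFunctor ℤ (E₁.openNormalSubgroup : Subgroup (absoluteGaloisGroup K))).obj X) 2)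
    (w₂ : groupCohomology ((invariantsQuotFunctor ℤ (E₂.openNormalSubgroup : Subgroup (absoluteGaloisGroup K))).obj X) 2)
    (h : infTwo K E₁.1 (toDGM X) (toAbsLayer E₁ X 2 w₁) = infTwo K E₂.1 (toDGM X) (toAbsLayer E₂ X 2 w₂)) :
    LayerColimit.inflG E₁.openNormalSubgroup X 2 w₁ = LayerColimit.inflG E₂.openNormalSubgroup X 2 w₂ := by
  obtain ⟨E', hfd, hn, h₁, h₂, heq⟩ :=
    (infTwo_eq_infTwo_iff_exists_layerInf_eq K E₁.1 (toDGM X) E₂.1 _ _).1 h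
  haveI := hfd
  haveI := hn
  haveI hgal : IsGalois K E' := IsGalois.mk
  -- the common layer as a `GalLayer`
  let E'' : GalLayer K := ⟨E', hfd, hgal⟩
  haveI : Normal K E''.1 := hn
  haveI : FiniteDimensional K E''.1 := hfd
  have h₁' : E₁ ≤ E'' := h₁
  have h₂' : E₂ ≤ E'' := h₂
  have key : toAbsLayer E'' X 2 (LayerColimit.stepG E₁.openNormalSubgroup E''.openNormalSubgroup
        (GalLayer.coe_openNormalSubgroup_le h₁') X 2 w₁) =
      toAbsLayer E'' X 2 (LayerColimit.stepG E₂.openNormalSubgroup E''.openNormalSubgroup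
        (GalLayer.coe_openNormalSubgroup_le h₂') X 2 w₂) :=
    ((layerInf_toAbsLayer E₁ E'' h₁' X 2 w₁).symm.trans heq).trans (layerInf_toAbsLayer E₂ E'' h₂' X 2 w₂)
  have hstep := toAbsLayer_injective E'' X 2 key
  rw [← LayerColimit.inflG_stepG E₁.openNormalSubgroup E''.openNormalSubgroup (GalLayer.coe_openNormalSubgroup_le h₁') X 2 w₁,
    ← LayerColimit.inflG_stepG E₂.openNormalSubgroup E''.openNormalSubgroup (GalLayer.coe_openNormalSubgroup_le h₂') X 2 w₂,
    hstep]

/-! ## §3 (T-Cα): for `C̄`, equal continuous inflations ⟹ equal invariants -/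

/-- **(T-Cα), `layerInv` form.**  For the idèle class module `C̄ = classBarD K` of a number field and layer classes
`wᵢ ∈ H²(Γ_K ⧸ U_{Eᵢ}, C̄^{U_{Eᵢ}})` with the same continuous inflation `infTwo (toAbsLayer wᵢ) ∈ H²_cont(Γ_K, C̄)`:
`layerInv E₁ w₁ = layerInv E₂ w₂` (door-c4's `classBarInv_inflG`: `inv_K (Inf_E w) = layerInv E w`, and (T-α)).
[cite: CasselsFrohlichANT1967, Ch. VII §11.2 (bis)][cite: SerreGaloisCohomology1997, I §2.2 Proposition 8] -/
theorem layerInv_eq_layerInv_of_infTwo_toAbsLayer_eq [NumberField K] (E₁ E₂ : GalLayer K)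
    [Normal K E₁.1] [Normal K E₂.1] [FiniteDimensional K E₁.1] [FiniteDimensional K E₂.1]
    (w₁ : groupCohomology (IdeleClassBar.layerRep E₁) 2) (w₂ : groupCohomology (IdeleClassBar.layerRep E₂) 2)
    (h : infTwo K E₁.1 (toDGM (classBarD K)) (toAbsLayer E₁ (classBarD K) 2 w₁) =
      infTwo K E₂.1 (toDGM (classBarD K)) (toAbsLayer E₂ (classBarD K) 2 w₂)) :
    layerInv E₁ w₁ = layerInv E₂ w₂ := by
  rw [← classBarInv_inflG E₁ w₁, ← classBarInv_inflG E₂ w₂,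
    inflG_eq_inflG_of_infTwo_toAbsLayer_eq (classBarD K) E₁ E₂ w₁ w₂ h]

/-- **(T-Cα), `classInvAll` form**: `inv_{E₁/K}(iso_{E₁} w₁) = inv_{E₂/K}(iso_{E₂} w₂)` whenever the continuous inflations of the
layer classes `w₁`, `w₂` of `C̄` coincide (`layerInv E w = classInvAll K E (layerCohomologyIso E 2 w)`, `layerInv_apply`).  The number
`classInvAll K E (iso_E w)` is therefore a function of the class `infTwo (toAbsLayer w) ∈ H²_cont(Γ_K, C̄)` alone (memo
S3-IDELE-DESCENT-w2g11 §3 (T-Cα)). [cite: CasselsFrohlichANT1967, Ch. VII §11.2 (bis)][cite: SerreGaloisCohomology1997, I §2.2 Proposition 8] -/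
theorem classInvAll_eq_classInvAll_of_infTwo_toAbsLayer_eq [NumberField K] (E₁ E₂ : GalLayer K)
    [Normal K E₁.1] [Normal K E₂.1] [FiniteDimensional K E₁.1] [FiniteDimensional K E₂.1]
    (w₁ : groupCohomology (IdeleClassBar.layerRep E₁) 2) (w₂ : groupCohomology (IdeleClassBar.layerRep E₂) 2)
    (h : infTwo K E₁.1 (toDGM (classBarD K)) (toAbsLayer E₁ (classBarD K) 2 w₁) =
      infTwo K E₂.1 (toDGM (classBarD K)) (toAbsLayer E₂ (classBarD K) 2 w₂)) :
    (haveI := E₁.numberField; haveI := E₁.isGalois;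
      IdeleCohomology.classInvAll K E₁.1 ((layerCohomologyIso E₁ 2).hom w₁)) =
      (haveI := E₂.numberField; haveI := E₂.isGalois;
        IdeleCohomology.classInvAll K E₂.1 ((layerCohomologyIso E₂ 2).hom w₂)) := by
  rw [← layerInv_apply, ← layerInv_apply]
  exact layerInv_eq_layerInv_of_infTwo_toAbsLayer_eq E₁ E₂ w₁ w₂ h

end Summit.BirchSwinnertonDyer.BirchSwinnertonDyer.Theorems.ShaTwoCochain

end
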